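import Summits.MatrixMultiplication.MatrixMultiplication.Theorems.SoloInformedCwTwoCertificates
import Literature.Computability.AlgebraicComplexity.SkewCoppersmithWinogradProofs
import Literature.Computability.AlgebraicComplexity.BorderRankCWDet3Seventeen
import Literature.Computability.AlgebraicComplexity.BorderRankSkewCW
import Literature.Computability.AlgebraicComplexity.SchonhageRectangular

/-!
# The twin door D1′: the skew little Coppersmith–Winograd tensor

The laser-method value bound `ω ≤ log_q(4ρ³/27)` of Coppersmith–Winograd (§11) uses only the block
*support* of `T_{cw,q}` and the fact that each of the three blocks is a non-degenerate pairing; it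
therefore holds verbatim for the skew tensor `T_{skewcw,q}` (`q = 2u`), whose `c₀`-block is the
symplectic form instead of the symmetric one (Conner–Gesmundo–Landsberg–Ventura 2022, §2.2:
"Theorem (cwbndk) also holds for `T_{skewcw,q}`"; "`R̃(T_{skewcw,2}) = 3` would imply `ω = 2`",
p. 5). The tree proves this (`CGLV2022_skewCw_rank_form_holds`, `omega_le_two_of_skewCw_one`,
growth form). This file records the consequences over the tree's constant `asymptoticRank`, in the
same shape as the `T_{cw,2}` door (`SoloInformedCwTwoDoor`, `SoloInformedCwTwoCertificates`):

* `omega_le_logb_of_asymptoticRank_skewCwTensor_one_lt` — `ω ≤ log₂(4ρ³/27)` for every real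
  `ρ > R̃(T_{skewcw,2})`;
* `matrixMultiplication_of_asymptoticRank_skewCwTensor_one_le_three` — **door D1′**:
  `R̃(T_{skewcw,2}) ≤ 3 ⇒ ω = 2`;
* `matrixMultiplication_of_cw_or_skewCw_door` — `ω = 2` follows from EITHER door;
* the skew window, all kernel facts of the Literature library assembled:
  `bR(T_{skewcw,2}) = 5` (CGLV Prop. 3.1, `CGLV2022_prop31_holds`), `R(T_{skewcw,2}) ≤ 5`,
  `bR(T_{skewcw,2}^{⊠2}) ≤ 17 < 25` (the `det₃` expression of Conner–Huang–Landsberg, certified in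
  `BorderRankCWDet3Seventeen`), whence `3 ≤ R̃(T_{skewcw,2}) ≤ √17 < 4.1232` (flattening rank `3`
  below, the level-`2` certificate above);
* `asymptoticRank_skewCwTensor_one_le_three_iff_certificates` — D1′ is again a statement about
  the existence of border-rank certificates `bR(T_{skewcw,2}^{⊠n}) ≤ (3+ε)^n` for every `ε > 0`.

Why this matters for the "sharpest statement": up to the block-preserving symmetry
`(A,B,C) ∈ GL₂³`, a tensor with the block support of `T_{cw,2}` and non-degenerate blocks is
`T_M = a₀⊗(b₁⊗c₁ + b₂⊗c₂) + b₀⊗(a₁⊗c₁ + a₂⊗c₂) + c₀⊗(∑ M_{jk} a_j⊗b_k)` with `M ∈ GL₂(ℂ)` determined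
up to congruence `M ↦ AMAᵀ`; `M` symmetric gives `T_{cw,2}`, `M` skew gives `T_{skewcw,2}`, and these
are the two members treated in print. The door "`ω = 2 ⟸ R̃ = 3`" is thus a family of doors indexed
by congruence classes; the kernel now holds the two named ones. Neither is known to be a degeneration
of the other (`bR` differs: `4` versus `5`), so neither door is known to imply the other.

[cite: ConnerGesmundoLandsbergVentura2022, §2.2 (arXiv Thm. 2.5), Prop. 3.1, §1.3, Lemma 2.4]
[cite: ConnerHuangLandsberg2020, §8]
[cite: CoppersmithWinograd1990, §11]
-/

noncomputable section

namespace Summit.MatrixMultiplication.MatrixMultiplication.Theorems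

open Literature.Computability.AlgebraicComplexity
open Literature.Barriers.MatrixMultiplication (flatteningRank_le_asymptoticRank
  one_le_tensorRank_of_ne_zero kroneckerPow_ne_zero)

/-! ## `ω ≤ log₂(4ρ³/27)` for every `ρ > R̃(T_skewcw,2)` -/

/-- **The skew Coppersmith–Winograd bound via the asymptotic rank**: for every real
`ρ > R̃(T_{skewcw,2})`, `ω(ℂ) ≤ log₂(4ρ³/27)`. Some power has `R(T^{⊠N₀}) ≤ ρ^{N₀}`
(`exists_tensorRank_kroneckerPow_mul_le`); apply the proved rank form
`CGLV2022_skewCw_rank_form_holds` at `u = 1`, `k = N₀`.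
[cite: ConnerGesmundoLandsbergVentura2022, §2.2 (arXiv Thm. 2.5)] -/
theorem omega_le_logb_of_asymptoticRank_skewCwTensor_one_lt {ρ : ℝ}
    (hρ : asymptoticRank (skewCwTensor ℂ 1) < ρ) :
    omega ℂ ≤ Real.logb 2 (4 * ρ ^ 3 / 27) := by
  have hε : 0 < ρ - asymptoticRank (skewCwTensor ℂ 1) := sub_pos.2 hρ
  have hρ0 : 0 < ρ := lt_of_le_of_lt (asymptoticRank_nonneg _) hρ
  obtain ⟨N₀, hN₀, hpow⟩ := exists_tensorRank_kroneckerPow_mul_le (skewCwTensor ℂ 1) hε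
  have hR : (tensorRank (kroneckerPow (skewCwTensor ℂ 1) N₀) : ℝ) ≤ ρ ^ N₀ := by
    have h := hpow 1
    rw [mul_one, add_sub_cancel] at h
    exact h
  have hR1 : (1 : ℝ) ≤ tensorRank (kroneckerPow (skewCwTensor ℂ 1) N₀) := by
    exact_mod_cast one_le_tensorRank_of_ne_zero
      (kroneckerPow_ne_zero (skewCwTensor_ne_zero ℂ 1 le_rfl) N₀)
  have hR0 : (0 : ℝ) ≤ tensorRank (kroneckerPow (skewCwTensor ℂ 1) N₀) := by linarith
  have h0 := CGLV2022_skewCw_rank_form_holds 1 N₀ le_rfl hN₀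
  have h : omega ℂ ≤ Real.logb 2 ((4 / 27) *
      ((tensorRank (kroneckerPow (skewCwTensor ℂ 1) N₀) : ℝ) ^ ((3 : ℝ) / N₀))) := by
    simpa only [Nat.cast_one, mul_one] using h0
  have hpos : (0 : ℝ) < (4 / 27) *
      (tensorRank (kroneckerPow (skewCwTensor ℂ 1) N₀) : ℝ) ^ ((3 : ℝ) / N₀) :=
    mul_pos (by norm_num) (Real.rpow_pos_of_pos (by linarith) _)
  refine h.trans (Real.logb_le_logb_of_le (by norm_num) hpos ?_)
  have hexp : (tensorRank (kroneckerPow (skewCwTensor ℂ 1) N₀) : ℝ) ^ ((3 : ℝ) / N₀) ≤ ρ ^ 3 := by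
    calc (tensorRank (kroneckerPow (skewCwTensor ℂ 1) N₀) : ℝ) ^ ((3 : ℝ) / N₀)
        ≤ (ρ ^ N₀) ^ ((3 : ℝ) / N₀) := Real.rpow_le_rpow hR0 hR (by positivity)
      _ = ρ ^ 3 := by
          have hN0 : (N₀ : ℝ) ≠ 0 := by exact_mod_cast (by omega : N₀ ≠ 0)
          rw [← Real.rpow_natCast ρ N₀, ← Real.rpow_mul hρ0.le,
            show (N₀ : ℝ) * ((3 : ℝ) / N₀) = ((3 : ℕ) : ℝ) by push_cast; field_simp,
            Real.rpow_natCast]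
  nlinarith [hexp]

/-! ## Door D1′ -/

/-- **D1′, exponent form**: `R̃(T_{skewcw,2}) ≤ 3 ⇒ ω(ℂ) ≤ 2` (for every `η > 0` take
`ρ = 3·2^{η/3} > 3`; then `log₂(4ρ³/27) = 2 + η`).
[cite: ConnerGesmundoLandsbergVentura2022, §2.2 (p. 5: "`R̃(T_skewcw,2) = 3` … `ω = 2`")] -/
theorem omega_le_two_of_asymptoticRank_skewCwTensor_one_le_three
    (h : asymptoticRank (skewCwTensor ℂ 1) ≤ 3) : omega ℂ ≤ 2 := by
  refine le_of_forall_pos_le_add fun η hη => ?_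
  have h2 : (1 : ℝ) < (2 : ℝ) ^ (η / 3) := Real.one_lt_rpow (by norm_num) (by positivity)
  have hρ3 : (3 : ℝ) < 3 * (2 : ℝ) ^ (η / 3) := by linarith
  have hA := omega_le_logb_of_asymptoticRank_skewCwTensor_one_lt (lt_of_le_of_lt h hρ3)
  have hcube : (3 * (2 : ℝ) ^ (η / 3)) ^ 3 = 27 * (2 : ℝ) ^ η := by
    rw [mul_pow]
    have e : ((2 : ℝ) ^ (η / 3)) ^ 3 = (2 : ℝ) ^ η := by
      rw [← Real.rpow_natCast, ← Real.rpow_mul (by norm_num : (0 : ℝ) ≤ 2)]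
      congr 1
      push_cast
      ring
    rw [e]
    norm_num
  have hval : Real.logb 2 (4 * (3 * (2 : ℝ) ^ (η / 3)) ^ 3 / 27) = 2 + η := by
    rw [hcube]
    have e : (4 : ℝ) * (27 * (2 : ℝ) ^ η) / 27 = (2 : ℝ) ^ ((2 : ℝ) + η) := by
      rw [Real.rpow_add (by norm_num : (0 : ℝ) < 2), Real.rpow_two]
      ring
    rw [e, Real.logb_rpow (by norm_num) (by norm_num)]
  rw [hval] at hA
  exact hA

/-- **Door D1′**: `R̃(T_{skewcw,2}) ≤ 3 ⇒ ω(ℂ) = 2` (the summit statement).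
[cite: ConnerGesmundoLandsbergVentura2022, §2.2] -/
theorem matrixMultiplication_of_asymptoticRank_skewCwTensor_one_le_three
    (h : asymptoticRank (skewCwTensor ℂ 1) ≤ 3) : _root_.MatrixMultiplication :=
  _root_.MatrixMultiplication_iff.2
    (le_antisymm (omega_le_two_of_asymptoticRank_skewCwTensor_one_le_three h) (omega_two_le ℂ))

/-- **Either door proves the summit**: `R̃(T_{cw,2}) ≤ 3 ∨ R̃(T_{skewcw,2}) ≤ 3 ⇒ ω(ℂ) = 2`.
[cite: ConnerGesmundoLandsbergVentura2022, p. 3 and §2.2] -/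
theorem matrixMultiplication_of_cw_or_skewCw_door
    (h : asymptoticRank (cwTensor ℂ 2) ≤ 3 ∨ asymptoticRank (skewCwTensor ℂ 1) ≤ 3) :
    _root_.MatrixMultiplication :=
  h.elim matrixMultiplication_of_asymptoticRank_cwTensor_two_le_three
    matrixMultiplication_of_asymptoticRank_skewCwTensor_one_le_three

/-! ## The skew window -/

/-- `bR(T_{skewcw,2}) = 5` (CGLV Prop. 3.1 and the five-term expression), from the Literature
library. [cite: ConnerGesmundoLandsbergVentura2022, Prop. 3.1, §1.3] -/
theorem algBorderRank_skewCwTensor_one_eq_five : algBorderRank (skewCwTensor ℂ 1) = 5 :=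
  CGLV2022_prop31_holds.2

/-- `bR(T_{skewcw,2}^{⊠2}) ≤ 17 < 25 = bR(T_{skewcw,2})²`: strict sub-multiplicativity already at the
square (`T_{skewcw,2}^{⊠2} ≅ det₃`, Conner–Huang–Landsberg's `17`-term expression, kernel-certified
in the Literature library). [cite: ConnerGesmundoLandsbergVentura2022, §1.3]
[cite: ConnerHuangLandsberg2020, §8] -/
theorem algBorderRank_kroneckerPow_skewCwTensor_one_two_lt_sq :
    algBorderRank (kroneckerPow (skewCwTensor ℂ 1) 2) ≤ 17 ∧
      algBorderRank (kroneckerPow (skewCwTensor ℂ 1) 2) < algBorderRank (skewCwTensor ℂ 1) ^ 2 :=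
  ⟨CGLV2022_borderRank_skewCw2_sq_le_holds,
    CGLV2022_borderRank_skewCw2_sq_le.lt_sq CGLV2022_borderRank_skewCw2_sq_le_holds
      CGLV2022_prop31_holds⟩

/-- **`ζ⁽¹⁾(T_{skewcw,2}) = 3`**: the three `a`-slices of `T_{skewcw,2}` are linearly independent
(evaluate a vanishing combination at `(b₁,c₁)` and at `(b₀,c_a)`), exactly as for `T_{cw,2}`
(`flatteningRank_cwTensor`). [folklore] -/
theorem flatteningRank_skewCwTensor_one {K : Type} [Field K] :
    flatteningRank (skewCwTensor K 1) = 3 := by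
  have h10 : (1 : Fin (2 * 1 + 1)) ≠ 0 := by decide
  have hli : LinearIndependent K (xSlices (skewCwTensor K 1)) := by
    rw [Fintype.linearIndependent_iff]
    intro g hg a
    have hev : ∀ b c : Fin (2 * 1 + 1), (∑ i, g i * skewCwTensor K 1 i b c) = 0 := by
      intro b c
      have := congrFun hg (b, c)
      simpa [Finset.sum_apply, Pi.smul_apply, xSlices_apply, smul_eq_mul] using this
    by_cases ha0 : a = 0
    · subst ha0
      have h1 := hev 1 1
      rw [Finset.sum_eq_single (0 : Fin (2 * 1 + 1))] at h1
      · simpa [skewCwTensor, h10] using h1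
      · intro i _ hi
        simp [skewCwTensor, hi, h10]
      · simp
    · have h1 := hev 0 a
      rw [Finset.sum_eq_single a] at h1
      · simpa [skewCwTensor, ha0] using h1
      · intro i _ hi
        simp [skewCwTensor, hi, ha0, Ne.symm ha0]
      · simp
  unfold flatteningRank
  rw [finrank_span_eq_card hli, Fintype.card_fin]

/-- **`3 ≤ R̃(T_{skewcw,2})`** (`ζ⁽¹⁾ ≤ R̃`). [cite: ChristandlVranaZuiddam2023, Example 1.4] -/
theorem three_le_asymptoticRank_skewCwTensor_one : (3 : ℝ) ≤ asymptoticRank (skewCwTensor ℂ 1) := by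
  have h := flatteningRank_le_asymptoticRank (skewCwTensor ℂ 1)
  rw [flatteningRank_skewCwTensor_one] at h
  exact_mod_cast h

/-- **`R̃(T_{skewcw,2}) ≤ √17 < 4.1232`**, the level-`2` certificate (`R̃(T)² ≤ bR(T^{⊠2}) ≤ 17`).
For comparison, the kernel bound for `T_{cw,2}` from level `2` is only `R̃ ≤ 4` (`bR ≤ 16`).
[cite: ConnerGesmundoLandsbergVentura2022, §1.3] -/
theorem asymptoticRank_skewCwTensor_one_le_sqrt_seventeen :
    asymptoticRank (skewCwTensor ℂ 1) ≤ Real.sqrt 17 := by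
  refine asymptoticRank_le_of_algBorderRank_kroneckerPow_le (skewCwTensor ℂ 1) two_pos
    (Real.sqrt_nonneg 17) ?_
  rw [Real.sq_sqrt (by norm_num)]
  exact_mod_cast CGLV2022_borderRank_skewCw2_sq_le_holds

/-- The skew window in one statement: `3 ≤ R̃(T_{skewcw,2}) ≤ √17`, `bR(T_{skewcw,2}) = 5`,
`bR(T_{skewcw,2}^{⊠2}) ≤ 17`. [cite: ConnerGesmundoLandsbergVentura2022, §1.3, Prop. 3.1] -/
theorem skewCwTensor_one_window :
    (3 : ℝ) ≤ asymptoticRank (skewCwTensor ℂ 1) ∧ asymptoticRank (skewCwTensor ℂ 1) ≤ Real.sqrt 17 ∧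
      algBorderRank (skewCwTensor ℂ 1) = 5 ∧ algBorderRank (kroneckerPow (skewCwTensor ℂ 1) 2) ≤ 17 :=
  ⟨three_le_asymptoticRank_skewCwTensor_one, asymptoticRank_skewCwTensor_one_le_sqrt_seventeen,
    algBorderRank_skewCwTensor_one_eq_five, CGLV2022_borderRank_skewCw2_sq_le_holds⟩

/-! ## D1′ as a certificate statement -/

/-- **`R̃(T_{skewcw,2}) ≤ 3 ↔` border-rank certificates `bR(T_{skewcw,2}^{⊠n}) ≤ (3+ε)^n` exist for
every `ε > 0`.** [cite: ChristandlVranaZuiddam2023, §1.1] -/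
theorem asymptoticRank_skewCwTensor_one_le_three_iff_certificates :
    asymptoticRank (skewCwTensor ℂ 1) ≤ 3 ↔
      ∀ ε : ℝ, 0 < ε → ∃ n : ℕ, 0 < n ∧
        (algBorderRank (kroneckerPow (skewCwTensor ℂ 1) n) : ℝ) ≤ (3 + ε) ^ n := by
  constructor
  · intro h ε hε
    obtain ⟨n, hn, hlt⟩ := exists_tensorRank_kroneckerPow_lt_of_asymptoticRank_lt
      (skewCwTensor ℂ 1) (show asymptoticRank (skewCwTensor ℂ 1) < 3 + ε by linarith)
    refine ⟨n, hn, le_trans ?_ hlt.le⟩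
    exact_mod_cast algBorderRank_le_tensorRank _
  · intro h
    refine le_of_forall_pos_le_add fun ε hε => ?_
    obtain ⟨n, hn, hle⟩ := h ε hε
    exact asymptoticRank_le_of_algBorderRank_kroneckerPow_le _ hn (by linarith) hle

/-- **D1′ ⟸ certificates**: a family of skew certificates proves `ω = 2`.
[cite: ConnerGesmundoLandsbergVentura2022, §2.2] -/
theorem matrixMultiplication_of_skewCw_borderRank_certificates
    (h : ∀ ε : ℝ, 0 < ε → ∃ n : ℕ, 0 < n ∧
      (algBorderRank (kroneckerPow (skewCwTensor ℂ 1) n) : ℝ) ≤ (3 + ε) ^ n) :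
    _root_.MatrixMultiplication :=
  matrixMultiplication_of_asymptoticRank_skewCwTensor_one_le_three
    (asymptoticRank_skewCwTensor_one_le_three_iff_certificates.2 h)

/-- **The first skew level is already excluded**: no `n = 1` certificate (`bR = 5 > 3 + ε` for
`ε < 2`) and at `n = 2` the certified value `17` gives exactly `R̃ ≤ √17`; an `n = 2` certificate of
quality `(3+ε)²` with `ε < √17 − 3 ≈ 1.123` would need `bR(det₃) ≤ 16`, which is open in the kernel
(in print `bR(det₃) = 17`, Conner–Harper–Landsberg 2019, so level `2` is closed in print).
Formally: `bR(T_{skewcw,2}^{⊠1}) > (3+ε)^1` for `ε < 2`. [cite: ConnerGesmundoLandsbergVentura2022, §1.3] -/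
theorem no_skew_certificate_level_one {ε : ℝ} (hε : ε < 2) :
    (3 + ε) ^ 1 < (algBorderRank (kroneckerPow (skewCwTensor ℂ 1) 1) : ℝ) := by
  have h5 : 5 ≤ algBorderRank (kroneckerPow (skewCwTensor ℂ 1) 1) := by
    have h := (tensorRestrictsTo_kroneckerPow_one (skewCwTensor ℂ 1)).algBorderRank_le
    rwa [algBorderRank_skewCwTensor_one_eq_five] at h
  have h5' : (5 : ℝ) ≤ (algBorderRank (kroneckerPow (skewCwTensor ℂ 1) 1) : ℝ) := by
    exact_mod_cast h5
  rw [pow_one]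
  linarith

end Summit.MatrixMultiplication.MatrixMultiplication.Theorems
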